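import Literature.NumberTheory.PAdicHodge.SenDecompletionUnique
import Literature.NumberTheory.PAdicHodge.SenDecompletionMatrix
import Literature.NumberTheory.PAdicHodge.TateLogCyclotomicClass
import Mathlib.LinearAlgebra.Matrix.NonsingularInverse
import HarnessLib

/-!
# Sen's decompletion of a cocycle over the cyclotomic tower (Berger–Colmez, Prop. 3.2.6)

Notation as in `SenDecompletionMatrix` / `SenDecompletionUnique`: `K₀ ≅ ℚ_p`, `ℂ_F`,
`X = \widehat{K_∞} ⊆ ℂ_F`, `K n = K₀(ζ_{pⁿ})`, `γ = γ_n = TateTrace.gen n` (`n ≥ 2`), `R_n = TateTrace.Rhat n`,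
`π = ‖p‖`, `G₀ = BaseGaloisGroup` acting entrywise on matrices over a finite index type `m`; all bounds are
entrywise.

This file assembles the pieces `SenDecompletionMatrix` (existence, Lemme 3.2.3/Cor. 3.2.4),
`TateTraceFixedLinear` ((TS2)(2)) and `SenDecompletionUnique` (Lemme 3.1.2, Lemme 3.2.5, propagation) into
the decompletion statement for a whole cocycle:

* `TateTrace.Rhat_eq_self_of_gen_smul_eq` — `R_n` is the identity on the `γ_n`-invariants of `X`
  ((TS2)(2): `R_{H,n}(x) = x` for `x ∈ Λ_{H,n}`).
* `TateTrace.gen_smul_comm_of_mem_X` — `G₀` acts on `X` through an abelian quotient: `γ τ x = τ γ x` on `X`.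
* `TateTrace.norm_fixed_conj_sub_one_le` — **a priori bound for the decompleted value**: if `B, U, W ∈ M_d(X)`,
  `W` is `γ`-fixed, `B W = U γ(B)`, `‖B − 1‖ ≤ d < ‖p‖` and `‖U − 1‖ ≤ u`, then `‖W − 1‖ ≤ ‖p‖⁻¹ u`
  (apply `R_n`, which fixes `W − 1`, is linear over `M_d(K_n)` and has norm `≤ ‖p‖⁻¹`).
* ★ `TateTrace.exists_matrix_conj_fixed_near_one` — Cor. 3.2.4 with the bound: for `‖U − 1‖ ≤ ‖p‖⁷` there is
  `B ∈ GL_d(X)`, `‖B − 1‖ ≤ ‖p‖²`, with `W = B⁻¹ U γ(B) ∈ M_d(X)^{γ = 1} = M_d(K_n)` AND `‖W − 1‖ ≤ ‖p‖⁶`.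
* ★★ `TateTrace.exists_matrix_conj_fixed_forall` — **Berger–Colmez Prop. 3.2.6 over the cyclotomic tower
  (the part after the `H`-descent).** Let `n ≥ 2`, `U_γ ∈ M_d(X)` with `‖U_γ − 1‖ ≤ ‖p‖⁷`. There is ONE
  `B ∈ GL_d(X)` (`‖B − 1‖ ≤ ‖p‖²`) such that `B⁻¹ U_γ γ(B)` is fixed by `γ` and, for EVERY `τ ∈ G₀` and every
  `U_τ ∈ M_d(X)` satisfying the commutation relation `U_γ γ(U_τ) = U_τ τ(U_γ)` (which the cocycle relation
  gives, `G₀` acting on `X` through its abelian quotient), `B⁻¹ U_τ τ(B)` is fixed by `γ` as well: the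
  whole cocycle is cohomologous, by a single coboundary, to one with values in `GL_d(K_n)`.

No named facts are used.

References: L. Berger, P. Colmez, Astérisque 319 (2008), Déf. 3.1.3 (TS2), Lemme 3.2.5, Prop. 3.2.6
[BergerColmez2008]; J. Tate, *p-divisible groups* (1967), §3.1–§3.3 [Tate1967]; S. Sen, *Continuous
cohomology and p-adic Galois representations*, Invent. Math. 62 (1980), Thm. 3 [Sen1980].
-/

noncomputable section

open ValuativeRel Field UniformSpace Filter Topology Finset

open scoped IntermediateField

namespace Literature.NumberTheory.PAdicHodge

open Literature.NumberTheory.GaloisRepresentations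
open Literature.NumberTheory.GaloisRepresentations.IsNonarchimedeanLocalField
open CyclotomicTower

variable {F : Type} [Field F] [ValuativeRel F] [TopologicalSpace F] [IsNonarchimedeanLocalField F]
  [CharZero F] {p : ℕ} [Fact p.Prime] (hp : valuation F p < 1)

namespace TateTrace

variable {m : Type} [Fintype m] [DecidableEq m]

/-! ### Ultrametric matrix toolkit over `ℂ_F` -/

omit [CharZero F] in
/-- `‖x + y‖ ≤ max ‖x‖ ‖y‖` in `ℂ_F`. [folklore] -/
private theorem norm_add_le_max' (x y : CompletedAlgClosure F) : ‖x + y‖ ≤ max ‖x‖ ‖y‖ :=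
  IsUltrametricDist.norm_add_le_max x y

omit [CharZero F] in
/-- `‖x - y‖ ≤ max ‖x‖ ‖y‖` in `ℂ_F`. [folklore] -/
private theorem norm_sub_le_max' (x y : CompletedAlgClosure F) : ‖x - y‖ ≤ max ‖x‖ ‖y‖ := by
  rw [sub_eq_add_neg, ← norm_neg y]; exact IsUltrametricDist.norm_add_le_max x (-y)

omit [CharZero F] in
/-- `‖1 + c‖ = 1` when `‖c‖ < 1`. [folklore] -/
private theorem norm_one_add_eq {c : CompletedAlgClosure F} (hc : ‖c‖ < 1) : ‖1 + c‖ = 1 := by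
  have h := IsUltrametricDist.norm_add_eq_max_of_norm_ne_norm (x := (1 : CompletedAlgClosure F)) (y := c)
    (by rw [norm_one]; exact hc.ne')
  rw [h, norm_one, max_eq_left hc.le]

omit [CharZero F] [DecidableEq m] in
/-- Entrywise bounds are submultiplicative over the ultrametric field `ℂ_F`:
`‖(A B) i j‖ ≤ (sup ‖A‖)(sup ‖B‖)`. [folklore] -/
private theorem norm_mul_apply_le {A B : Matrix m m (CompletedAlgClosure F)} {a b : ℝ} (ha : 0 ≤ a)
    (hb : 0 ≤ b) (hA : ∀ i j, ‖A i j‖ ≤ a) (hB : ∀ i j, ‖B i j‖ ≤ b) (i j : m) :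
    ‖(A * B) i j‖ ≤ a * b := by
  rw [Matrix.mul_apply]
  exact IsUltrametricDist.norm_sum_le_of_forall_le_of_nonneg (mul_nonneg ha hb)
    fun k _ => by rw [norm_mul]; exact mul_le_mul (hA i k) (hB k j) (norm_nonneg _) ha

omit [CharZero F] [Fintype m] [DecidableEq m] in
/-- `‖(A - B) i j‖ ≤ max`. [folklore] -/
private theorem norm_sub_apply_le {A B : Matrix m m (CompletedAlgClosure F)} {a b : ℝ}
    (hA : ∀ i j, ‖A i j‖ ≤ a) (hB : ∀ i j, ‖B i j‖ ≤ b) (i j : m) :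
    ‖(A - B) i j‖ ≤ max a b := by
  rw [Matrix.sub_apply]
  exact (norm_sub_le_max' _ _).trans (max_le_max (hA i j) (hB i j))

omit [CharZero F] [Fintype m] [DecidableEq m] in
/-- `‖(A + B) i j‖ ≤ max`. [folklore] -/
private theorem norm_add_apply_le {A B : Matrix m m (CompletedAlgClosure F)} {a b : ℝ}
    (hA : ∀ i j, ‖A i j‖ ≤ a) (hB : ∀ i j, ‖B i j‖ ≤ b) (i j : m) :
    ‖(A + B) i j‖ ≤ max a b := by
  rw [Matrix.add_apply]
  exact (norm_add_le_max' _ _).trans (max_le_max (hA i j) (hB i j))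

omit [CharZero F] in
/-- The determinant of a matrix with entries of norm `≤ 1` has norm `≤ 1`. [folklore] -/
private theorem norm_det_le_one {A : Matrix m m (CompletedAlgClosure F)} (hA : ∀ i j, ‖A i j‖ ≤ 1) :
    ‖A.det‖ ≤ 1 := by
  rw [Matrix.det_apply']
  refine IsUltrametricDist.norm_sum_le_of_forall_le_of_nonneg zero_le_one fun σ _ => ?_
  have h1 : ‖(((Equiv.Perm.sign σ : ℤˣ) : ℤ) : CompletedAlgClosure F)‖ = 1 := by
    rcases Int.units_eq_one_or (Equiv.Perm.sign σ) with h | h <;> simp [h]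
  rw [norm_mul, h1, one_mul, norm_prod]
  exact Finset.prod_le_one (fun i _ => norm_nonneg _) fun i _ => hA _ _

omit [CharZero F] [Fintype m] in
/-- Entries of `1 + C`, `‖C‖ ≤ r ≤ 1`: norm `≤ 1`, and the off-diagonal ones `≤ r`. [folklore] -/
private theorem norm_one_add_apply_le {C : Matrix m m (CompletedAlgClosure F)} {r : ℝ} (hr1 : r ≤ 1)
    (hC : ∀ i j, ‖C i j‖ ≤ r) (i j : m) :
    ‖(1 + C : Matrix m m (CompletedAlgClosure F)) i j‖ ≤ 1 ∧
      (i ≠ j → ‖(1 + C : Matrix m m (CompletedAlgClosure F)) i j‖ ≤ r) := by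
  rw [Matrix.add_apply]
  by_cases hij : i = j
  · subst hij
    rw [Matrix.one_apply_eq]
    refine ⟨(norm_add_le_max' _ _).trans ?_, fun h => (h rfl).elim⟩
    rw [norm_one]; exact max_le le_rfl ((hC i i).trans hr1)
  · rw [Matrix.one_apply_ne hij, zero_add]
    exact ⟨(hC i j).trans hr1, fun _ => hC i j⟩

omit [CharZero F] [Fintype m] in
/-- `‖∏ (1 + c_i) − 1‖ ≤ r` when all `‖c_i‖ ≤ r ≤ 1`. [folklore] -/
private theorem norm_prod_one_add_sub_one_le {s : Finset m} {c : m → CompletedAlgClosure F} {r : ℝ}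
    (hr0 : 0 ≤ r) (hr1 : r ≤ 1) (hc : ∀ i, ‖c i‖ ≤ r) : ‖∏ i ∈ s, (1 + c i) - 1‖ ≤ r := by
  induction s using Finset.induction_on with
  | empty => rw [Finset.prod_empty, sub_self, norm_zero]; exact hr0
  | @insert a s ha ih =>
    rw [Finset.prod_insert ha]
    set P := ∏ i ∈ s, (1 + c i)
    have hP : ‖P‖ ≤ 1 := by
      have h := norm_add_le_max' (P - 1) 1
      rw [sub_add_cancel, norm_one] at h
      exact h.trans (max_le (ih.trans hr1) le_rfl)
    have h : (1 + c a) * P - 1 = (P - 1) + c a * P := by ring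
    rw [h]
    refine (norm_add_le_max' _ _).trans (max_le ih ?_)
    rw [norm_mul]
    calc ‖c a‖ * ‖P‖ ≤ r * 1 := mul_le_mul (hc a) hP (norm_nonneg _) hr0
      _ = r := mul_one r

omit [CharZero F] in
/-- **`‖det(1 + C) − 1‖ ≤ ‖C‖` for `‖C‖ < 1`** (Leibniz expansion: the diagonal term is
`∏(1 + C_ii)`, every other term has an off-diagonal factor). [folklore] -/
private theorem norm_det_one_add_sub_one_le {C : Matrix m m (CompletedAlgClosure F)} {r : ℝ}
    (hr0 : 0 ≤ r) (hr1 : r < 1) (hC : ∀ i j, ‖C i j‖ ≤ r) :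
    ‖(1 + C : Matrix m m (CompletedAlgClosure F)).det - 1‖ ≤ r := by
  have hent := norm_one_add_apply_le hr1.le hC
  rw [Matrix.det_apply', ← Finset.sum_erase_add _ _ (Finset.mem_univ (1 : Equiv.Perm m))]
  simp only [Equiv.Perm.sign_one, Units.val_one, Int.cast_one, one_mul, Equiv.Perm.one_apply]
  rw [add_sub_assoc]
  refine (norm_add_le_max' _ _).trans (max_le ?_ ?_)
  · refine IsUltrametricDist.norm_sum_le_of_forall_le_of_nonneg hr0 fun σ hσ => ?_
    have hσ1 : σ ≠ 1 := Finset.ne_of_mem_erase hσ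
    obtain ⟨i₀, hi₀⟩ : ∃ i, σ i ≠ i := not_forall.mp fun h => hσ1 (Equiv.ext h)
    have h1 : ‖(((Equiv.Perm.sign σ : ℤˣ) : ℤ) : CompletedAlgClosure F)‖ = 1 := by
      rcases Int.units_eq_one_or (Equiv.Perm.sign σ) with h | h <;> simp [h]
    rw [norm_mul, h1, one_mul, ← Finset.prod_erase_mul _ _ (Finset.mem_univ i₀), norm_mul]
    calc ‖∏ i ∈ Finset.univ.erase i₀, (1 + C : Matrix m m (CompletedAlgClosure F)) (σ i) i‖ *
          ‖(1 + C : Matrix m m (CompletedAlgClosure F)) (σ i₀) i₀‖ ≤ 1 * r := by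
          refine mul_le_mul ?_ ((hent _ _).2 hi₀) (norm_nonneg _) zero_le_one
          rw [norm_prod]
          exact Finset.prod_le_one (fun i _ => norm_nonneg _) fun i _ => (hent _ _).1
      _ = r := one_mul r
  · simp only [Matrix.add_apply, Matrix.one_apply_eq]
    exact norm_prod_one_add_sub_one_le hr0 hr1.le fun i => hC i i

omit [CharZero F] in
/-- **`1 + C` is invertible for `‖C‖ < 1`**, with `‖det(1 + C)‖ = 1`. [folklore] -/
private theorem norm_det_one_add_eq_one {C : Matrix m m (CompletedAlgClosure F)} {r : ℝ}
    (hr0 : 0 ≤ r) (hr1 : r < 1) (hC : ∀ i j, ‖C i j‖ ≤ r) :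
    ‖(1 + C : Matrix m m (CompletedAlgClosure F)).det‖ = 1 := by
  have h := norm_det_one_add_sub_one_le hr0 hr1 hC
  have h1 : (1 + C : Matrix m m (CompletedAlgClosure F)).det =
      1 + ((1 + C : Matrix m m (CompletedAlgClosure F)).det - 1) := by ring
  rw [h1]
  exact norm_one_add_eq (h.trans_lt hr1)

omit [CharZero F] in
/-- `B` with `‖B − 1‖ < 1` (entrywise `≤ r < 1`) has `‖det B‖ = 1`, so is invertible. [folklore] -/
private theorem isUnit_det_of_norm_sub_one_le {B : Matrix m m (CompletedAlgClosure F)} {r : ℝ}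
    (hr0 : 0 ≤ r) (hr1 : r < 1) (hB : ∀ i j, ‖(B - 1) i j‖ ≤ r) : IsUnit B.det := by
  have h := norm_det_one_add_eq_one hr0 hr1 hB
  rw [add_sub_cancel] at h
  refine isUnit_iff_ne_zero.mpr fun h0 => ?_
  rw [h0, norm_zero] at h
  exact zero_ne_one h

omit [CharZero F] in
/-- **`‖(1 + C)⁻¹‖ ≤ 1` for `‖C‖ < 1`** (adjugate formula). [folklore] -/
private theorem norm_inv_one_add_apply_le {C : Matrix m m (CompletedAlgClosure F)} {r : ℝ}
    (hr0 : 0 ≤ r) (hr1 : r < 1) (hC : ∀ i j, ‖C i j‖ ≤ r) (i j : m) :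
    ‖(1 + C : Matrix m m (CompletedAlgClosure F))⁻¹ i j‖ ≤ 1 := by
  have hdet := norm_det_one_add_eq_one hr0 hr1 hC
  have hent := norm_one_add_apply_le hr1.le hC
  rw [Matrix.inv_def, Matrix.smul_apply, smul_eq_mul, Ring.inverse_eq_inv, norm_mul, norm_inv, hdet,
    inv_one, one_mul, Matrix.adjugate_apply]
  refine norm_det_le_one fun i' j' => ?_
  rw [Matrix.updateRow_apply]
  split_ifs with h
  · by_cases hij : j' = i
    · subst hij; rw [Pi.single_eq_same, norm_one]
    · rw [Pi.single_eq_of_ne hij, norm_zero]; exact zero_le_one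
  · exact (hent _ _).1

/-! ### Matrices with entries in the subfield `X` -/

/-- `X` as a subring of `ℂ_F` (existence only; no new constant). [folklore] -/
private theorem exists_subring_coe_eq_X :
    ∃ R : Subring (CompletedAlgClosure F), (R : Set (CompletedAlgClosure F)) = X hp :=
  ⟨{ carrier := X hp
     mul_mem' := fun ha hb => mul_mem_X hp ha hb
     one_mem' := one_mem_X hp
     add_mem' := fun ha hb => add_mem_X hp ha hb
     zero_mem' := zero_mem_X hp
     neg_mem' := fun ha => neg_mem_X hp ha }, rfl⟩

omit [DecidableEq m] in
/-- Products of matrices over `X` are over `X`. [folklore] -/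
private theorem mul_apply_mem_X {A B : Matrix m m (CompletedAlgClosure F)} (hA : ∀ i j, A i j ∈ X hp)
    (hB : ∀ i j, B i j ∈ X hp) (i j : m) : (A * B) i j ∈ X hp := by
  rw [Matrix.mul_apply]
  exact sum_mem_X hp _ _ fun k _ => mul_mem_X hp (hA i k) (hB k j)

omit [Fintype m] [DecidableEq m] in
/-- Sums / differences / `1` / `γ`-images of matrices over `X` are over `X`. [folklore] -/
private theorem add_apply_mem_X {A B : Matrix m m (CompletedAlgClosure F)} (hA : ∀ i j, A i j ∈ X hp)
    (hB : ∀ i j, B i j ∈ X hp) (i j : m) : (A + B) i j ∈ X hp := by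
  rw [Matrix.add_apply]; exact add_mem_X hp (hA i j) (hB i j)

omit [Fintype m] [DecidableEq m] in
/-- see `add_apply_mem_X`. [folklore] -/
private theorem sub_apply_mem_X {A B : Matrix m m (CompletedAlgClosure F)} (hA : ∀ i j, A i j ∈ X hp)
    (hB : ∀ i j, B i j ∈ X hp) (i j : m) : (A - B) i j ∈ X hp := by
  rw [Matrix.sub_apply]; exact sub_mem_X hp (hA i j) (hB i j)

omit [Fintype m] in
/-- see `add_apply_mem_X`. [folklore] -/
private theorem one_apply_mem_X (i j : m) : (1 : Matrix m m (CompletedAlgClosure F)) i j ∈ X hp := by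
  rw [Matrix.one_apply]
  split_ifs
  · exact one_mem_X hp
  · exact zero_mem_X hp

omit [Fintype m] [DecidableEq m] in
/-- see `add_apply_mem_X`. [folklore] -/
private theorem map_smul_apply_mem_X (g : BaseGaloisGroup hp) {A : Matrix m m (CompletedAlgClosure F)}
    (hA : ∀ i j, A i j ∈ X hp) (i j : m) : (A.map fun x => g • x) i j ∈ X hp := by
  rw [Matrix.map_apply]; exact smul_mem_X hp g (hA i j)

/-- The inverse of a matrix over the subfield `X` is over `X` (adjugate and determinant are
polynomials in the entries). [folklore] -/
private theorem inv_apply_mem_X {A : Matrix m m (CompletedAlgClosure F)} (hA : ∀ i j, A i j ∈ X hp)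
    (i j : m) : A⁻¹ i j ∈ X hp := by
  obtain ⟨R, hR⟩ := exists_subring_coe_eq_X hp
  have hmem : ∀ i j, A i j ∈ R := fun i j => by rw [← SetLike.mem_coe, hR]; exact hA i j
  set A' : Matrix m m R := fun i j => ⟨A i j, hmem i j⟩ with hA'
  have hAA' : R.subtype.mapMatrix A' = A := by
    ext i j; rfl
  have hdet : A.det ∈ X hp := by
    rw [← hR, SetLike.mem_coe, ← hAA', ← RingHom.map_det]
    exact (A'.det).2
  have hadj : A.adjugate i j ∈ X hp := by
    rw [← hR, SetLike.mem_coe, ← hAA', ← RingHom.map_adjugate]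
    exact (A'.adjugate i j).2
  rw [Matrix.inv_def, Matrix.smul_apply, smul_eq_mul, Ring.inverse_eq_inv]
  exact mul_mem_X hp (inv_mem_X hp hdet) hadj

omit [Fintype m] in
/-- `G₀` fixes the entries of the identity matrix. [folklore] -/
private theorem smul_one_apply (g : BaseGaloisGroup hp) (i j : m) :
    g • (1 : Matrix m m (CompletedAlgClosure F)) i j = (1 : Matrix m m (CompletedAlgClosure F)) i j := by
  rw [Matrix.one_apply]
  split_ifs
  · exact smul_one g
  · exact smul_zero g

/-- `γ_n` fixes `K n` pointwise. [folklore] -/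
private theorem gen_smul_eq_self_of_mem_K {n : ℕ} (hn : 1 ≤ n) {x : NormedAlgClosure F}
    (hx : x ∈ K hp n) : gen hp n • x = x := by
  have h := gen_smul_zeta_self hp hn
  have h1 : gen hp n • zeta F p n = (1 : BaseGaloisGroup hp) • zeta F p n := by rw [h, one_smul]
  have h2 := smul_eq_smul_of_smul_zeta_eq hp h1 hx
  rwa [one_smul] at h2

/-- `G₀` preserves the `γ_n`-invariants of `X` (it acts on `X ⊇ K n` through an abelian quotient).
[folklore] -/
private theorem gen_smul_base_smul_eq {n : ℕ} (hn : 2 ≤ n) (τ : BaseGaloisGroup hp)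
    {w : CompletedAlgClosure F} (hwX : w ∈ X hp) (hγw : gen hp n • w = w) :
    gen hp n • τ • w = τ • w := by
  obtain ⟨w₀, hw₀, rfl⟩ := mem_image_K_of_gen_smul_eq hp hn hwX hγw
  rw [CompletedAlgClosure.base_smul_coe, CompletedAlgClosure.base_smul_coe,
    gen_smul_eq_self_of_mem_K hp (by omega) (smul_mem_K hp τ hw₀)]


/-- `γ`-fixed matrices have `γ`-fixed inverses. [folklore] -/
private theorem map_inv_eq_of_map_eq' {n : ℕ} {W : Matrix m m (CompletedAlgClosure F)}
    (hdet : IsUnit W.det) (hγW : ∀ i j, gen hp n • W i j = W i j) (i j : m) :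
    gen hp n • W⁻¹ i j = W⁻¹ i j := by
  set f : CompletedAlgClosure F →+* CompletedAlgClosure F :=
    MulSemiringAction.toRingHom (BaseGaloisGroup hp) (CompletedAlgClosure F) (gen hp n) with hf_def
  have hWf : W.map f = W := by
    ext k l; rw [Matrix.map_apply]; exact hγW k l
  have h1 : (W⁻¹).map f * W = 1 := by
    calc (W⁻¹).map f * W = (W⁻¹).map f * W.map f := by rw [hWf]
      _ = (W⁻¹ * W).map f := by rw [← Matrix.map_mul]
      _ = 1 := by rw [Matrix.nonsing_inv_mul W hdet, Matrix.map_one f (map_zero f) (map_one f)]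
  have h2 : W⁻¹ = (W⁻¹).map f := Matrix.inv_eq_left_inv h1
  have h3 := congrFun (congrFun h2 i) j
  rw [Matrix.map_apply] at h3
  exact h3.symm

/-! ### `R_n` is the identity on `M_d(K_n)`; `G₀` acts on `X` through an abelian quotient -/

/-- **`R_n x = x` for `γ_n`-fixed `x ∈ X`** ((TS2)(2): `R_{H,n}` is the identity on `Λ_{H,n}`).
[cite: BergerColmez2008, Déf. 3.1.3 (TS2)(2)] [cite: Tate1967, §3.1] -/
theorem Rhat_eq_self_of_gen_smul_eq {n : ℕ} (hn : 2 ≤ n) {w : CompletedAlgClosure F} (hwX : w ∈ X hp)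
    (hγw : gen hp n • w = w) : Rhat hp n ⟨w, hwX⟩ = w := by
  have h1 : (⟨w, hwX⟩ : X hp) = ⟨w * ((⟨ι hp 1, ι_mem_X hp 1⟩ : X hp) : CompletedAlgClosure F),
      mul_mem_X hp hwX (ι_mem_X hp 1)⟩ := by
    apply Subtype.ext
    show w = w * ι hp 1
    rw [← ιHom_apply, map_one, mul_one]
  rw [h1, Rhat_mul_of_gen_smul_eq hp hn hwX hγw, Rhat_ι hp hn, ← ιHom_apply, map_one, mul_one]

/-- **`G₀` acts on `X` through an abelian quotient**: `γ_n (τ x) = τ (γ_n x)` for `x ∈ X` and every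
`τ ∈ G₀` (both composites act on every `ζ_{p^M}` through `χ(γ_n) χ(τ)`; Ax–Sen–Tate).
[cite: Tate1967, §3.3 Theorem 1] -/
theorem gen_smul_comm_of_mem_X (n : ℕ) (τ : BaseGaloisGroup hp) {x : CompletedAlgClosure F}
    (hx : x ∈ X hp) : gen hp n • τ • x = τ • gen hp n • x := by
  rw [← mul_smul, ← mul_smul]
  refine base_smul_eq_of_forall_smul_zeta_eq hp (fun M => ?_) hx
  rw [BaseGaloisGroup.baseCyclotomicCharacter_spec hp (gen hp n * τ) (zeta F p M)
      (zeta_spec F p M).pow_eq_one,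
    BaseGaloisGroup.baseCyclotomicCharacter_spec hp (τ * gen hp n) (zeta F p M)
      (zeta_spec F p M).pow_eq_one, map_mul, map_mul, mul_comm]

omit [Fintype m] [DecidableEq m] in
/-- Matrix form of `gen_smul_comm_of_mem_X`: `γ(τ(B)) = τ(γ(B))` for `B ∈ M_d(X)`. [cite: Tate1967, §3.3 Theorem 1] -/
theorem map_gen_map_base_comm (n : ℕ) (τ : BaseGaloisGroup hp) {B : Matrix m m (CompletedAlgClosure F)}
    (hB : ∀ i j, B i j ∈ X hp) :
    (B.map fun x => τ • x).map (fun x => gen hp n • x) = (B.map fun x => gen hp n • x).map fun x => τ • x := by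
  ext i j
  simp only [Matrix.map_apply]
  exact gen_smul_comm_of_mem_X hp n τ (hB i j)

/-! ### The a priori bound `‖W − 1‖ ≤ ‖p‖⁻¹ ‖U − 1‖` for the decompleted value -/

/-- **A priori bound.** Let `n ≥ 2`, `B, U, W ∈ M_d(X)` with `W` fixed by `γ = γ_n` entrywise and
`B · W = U · γ(B)`; if `‖B − 1‖ ≤ d < ‖p‖` and `‖U − 1‖ ≤ u` (entrywise) then `‖W − 1‖ ≤ ‖p‖⁻¹ u`.
Proof: with `D = B − 1`, `E = U − 1`, `T = W − 1` one has `T = E + E γ(D) + γ(D) − D W`; applying `R_n`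
entrywise (it fixes `T`, kills `γ(D) − D` modulo `R_n`, is `M_d(K_n)`-linear and has norm `≤ ‖p‖⁻¹`) gives
`T = R_n(E + Eγ(D)) − R_n(D) T`, so `‖T‖ ≤ max(‖p‖⁻¹ u, ‖p‖⁻¹ d ‖T‖)` and `‖p‖⁻¹ d < 1`.
[cite: BergerColmez2008, Déf. 3.1.3 (TS2) and Prop. 3.2.6] [cite: Tate1967, §3.1 Prop. 6] -/
theorem norm_fixed_conj_sub_one_le {n : ℕ} (hn : 2 ≤ n) {B U W : Matrix m m (CompletedAlgClosure F)}
    (hB : ∀ i j, B i j ∈ X hp) (hU : ∀ i j, U i j ∈ X hp) (hW : ∀ i j, W i j ∈ X hp)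
    (hγW : ∀ i j, gen hp n • W i j = W i j) (hBW : B * W = U * B.map fun x => gen hp n • x)
    {d u : ℝ} (hd0 : 0 ≤ d) (hd : d < ‖(p : PadicBase F p hp)‖) (hu0 : 0 ≤ u)
    (hBd : ∀ i j, ‖(B - 1) i j‖ ≤ d) (hUu : ∀ i j, ‖(U - 1) i j‖ ≤ u) :
    ∀ i j, ‖(W - 1) i j‖ ≤ ‖(p : PadicBase F p hp)‖⁻¹ * u := by
  rcases isEmpty_or_nonempty m with hm | ⟨⟨i₁⟩⟩
  · exact fun i => isEmptyElim i
  set π : ℝ := ‖(p : PadicBase F p hp)‖ with hπ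
  have hπ0 : 0 < π := norm_pos_iff.mpr (by exact_mod_cast (Fact.out : p.Prime).ne_zero)
  have hπ1 : π < 1 := PadicBase.norm_p_lt_one hp
  have hπi0 : 0 ≤ π⁻¹ := inv_nonneg.mpr hπ0.le
  have hd1 : d ≤ 1 := (hd.trans hπ1).le
  set f : CompletedAlgClosure F →+* CompletedAlgClosure F :=
    MulSemiringAction.toRingHom (BaseGaloisGroup hp) (CompletedAlgClosure F) (gen hp n) with hf_def
  have hf : (fun x : CompletedAlgClosure F => gen hp n • x) = ⇑f := by
    funext x; simp [hf_def]
  rw [hf] at hBW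
  -- the pieces `D = B − 1`, `E = U − 1`, `T = W − 1`, `Dγ = γ(D) = γ(B) − 1`
  have hDX : ∀ i j, (B - 1) i j ∈ X hp := sub_apply_mem_X hp hB (one_apply_mem_X hp)
  have hEX : ∀ i j, (U - 1) i j ∈ X hp := sub_apply_mem_X hp hU (one_apply_mem_X hp)
  have hTX : ∀ i j, (W - 1) i j ∈ X hp := sub_apply_mem_X hp hW (one_apply_mem_X hp)
  have hγT : ∀ i j, gen hp n • (W - 1) i j = (W - 1) i j := fun i j => by
    rw [Matrix.sub_apply, smul_sub, hγW, smul_one_apply hp]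
  have hDγ : B.map f - 1 = (B - 1).map f := by
    rw [Matrix.map_sub f (map_sub f), Matrix.map_one f (map_zero f) (map_one f)]
  have hDγX : ∀ i j, (B.map f - 1) i j ∈ X hp := fun i j => by
    rw [hDγ, Matrix.map_apply]; exact smul_mem_X hp _ (hDX i j)
  have hDγd : ∀ i j, ‖(B.map f - 1) i j‖ ≤ d := fun i j => by
    rw [hDγ, Matrix.map_apply]
    show ‖gen hp n • (B - 1) i j‖ ≤ d
    rw [CompletedAlgClosure.norm_base_smul hp]; exact hBd i j
  -- `e = E + E γ(D)`, `‖e‖ ≤ u`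
  have heX : ∀ i j, (U - 1 + (U - 1) * (B.map f - 1)) i j ∈ X hp :=
    add_apply_mem_X hp hEX (mul_apply_mem_X hp hEX hDγX)
  have heu : ∀ i j, ‖(U - 1 + (U - 1) * (B.map f - 1)) i j‖ ≤ u := fun i j =>
    (norm_add_apply_le hUu (norm_mul_apply_le hu0 hd0 hUu hDγd) i j).trans
      (max_le le_rfl (by nlinarith))
  -- the identity `T = e + (γ(D) − D W)`
  have hid : W - 1 = (U - 1 + (U - 1) * (B.map f - 1)) + ((B.map f - 1) - (B - 1) * W) := by
    have h : (U - 1 + (U - 1) * (B.map f - 1)) + ((B.map f - 1) - (B - 1) * W) =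
        U * B.map f - 1 - B * W + W := by noncomm_ring
    rw [h, hBW]; abel
  -- `RD = R_n(D)` entrywise; `‖RD‖ ≤ π⁻¹ d`
  set RD : Matrix m m (CompletedAlgClosure F) := Matrix.of fun k l => Rhat hp n ⟨(B - 1) k l, hDX k l⟩
    with hRD_def
  have hRD_apply : ∀ k l, RD k l = Rhat hp n ⟨(B - 1) k l, hDX k l⟩ := fun k l => rfl
  have hRDn : ∀ k l, ‖RD k l‖ ≤ π⁻¹ * d := fun k l => by
    rw [hRD_apply]
    exact (norm_Rhat_le hp hn _).trans (mul_le_mul_of_nonneg_left (hBd k l) hπi0)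
  -- apply `R_n` entrywise: `T_{ij} = R_n(e_{ij}) + (RD_{ij} − (RD W)_{ij})`
  have hRT : ∀ i j, (W - 1) i j =
      Rhat hp n ⟨(U - 1 + (U - 1) * (B.map f - 1)) i j, heX i j⟩ + (RD i j - (RD * W) i j) := by
    intro i j
    -- `R_n(T_{ij}) = T_{ij}`
    have h0 : Rhat hp n ⟨(W - 1) i j, hTX i j⟩ = (W - 1) i j :=
      Rhat_eq_self_of_gen_smul_eq hp hn (hTX i j) (hγT i j)
    -- split `T = e + (γD − D W)` under `R_n`
    have hgX : ∀ i j, ((B.map f - 1) - (B - 1) * W) i j ∈ X hp :=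
      sub_apply_mem_X hp hDγX (mul_apply_mem_X hp hDX hW)
    have h1 : (⟨(W - 1) i j, hTX i j⟩ : X hp) =
        ⟨((⟨(U - 1 + (U - 1) * (B.map f - 1)) i j, heX i j⟩ : X hp) : CompletedAlgClosure F) +
          ((⟨((B.map f - 1) - (B - 1) * W) i j, hgX i j⟩ : X hp) : CompletedAlgClosure F),
          add_mem_X hp (heX i j) (hgX i j)⟩ := by
      apply Subtype.ext
      show (W - 1) i j = (U - 1 + (U - 1) * (B.map f - 1)) i j + ((B.map f - 1) - (B - 1) * W) i j
      rw [← Matrix.add_apply, ← hid]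
    -- `R_n((γD − DW)_{ij}) = R_n(γ D_{ij}) − R_n((D W)_{ij}) = RD_{ij} − (RD W)_{ij}`
    have hDWX : ∀ i j, ((B - 1) * W) i j ∈ X hp := mul_apply_mem_X hp hDX hW
    have h2 : (⟨((B.map f - 1) - (B - 1) * W) i j, hgX i j⟩ : X hp) =
        ⟨((⟨(B.map f - 1) i j, hDγX i j⟩ : X hp) : CompletedAlgClosure F) -
          ((⟨((B - 1) * W) i j, hDWX i j⟩ : X hp) : CompletedAlgClosure F),
          sub_mem_X hp (hDγX i j) (hDWX i j)⟩ := Subtype.ext (Matrix.sub_apply _ _ _ _)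
    have h3 : Rhat hp n ⟨(B.map f - 1) i j, hDγX i j⟩ = RD i j := by
      have h4 : (⟨(B.map f - 1) i j, hDγX i j⟩ : X hp) = genX hp n ⟨(B - 1) i j, hDX i j⟩ := by
        apply Subtype.ext
        show (B.map f - 1) i j = gen hp n • (B - 1) i j
        rw [hDγ, Matrix.map_apply, ← hf]
      rw [h4, Rhat_genX hp hn, hRD_apply]
    have h5 : Rhat hp n ⟨((B - 1) * W) i j, hDWX i j⟩ = (RD * W) i j := by
      have h6 : (⟨((B - 1) * W) i j, hDWX i j⟩ : X hp) =
          ⟨((1 : Matrix m m (CompletedAlgClosure F)) * (B - 1) * W) i j,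
            by rw [Matrix.one_mul]; exact hDWX i j⟩ :=
        Subtype.ext (show ((B - 1) * W) i j = ((1 : Matrix m m (CompletedAlgClosure F)) * (B - 1) * W) i j
          by rw [Matrix.one_mul])
      rw [h6, Rhat_mul_mul_apply hp hn hDX (one_apply_mem_X hp) hW (smul_one_apply hp (gen hp n)) hγW,
        Matrix.one_mul]
    rw [← h0, h1, Rhat_add hp hn, h2, Rhat_sub hp hn, h3, h5]
  -- the largest entry of `T`
  haveI : Nonempty (m × m) := ⟨(i₁, i₁)⟩
  obtain ⟨⟨i₀, j₀⟩, -, hmax⟩ := Finset.exists_max_image (Finset.univ : Finset (m × m))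
    (fun q => ‖(W - 1) q.1 q.2‖) Finset.univ_nonempty
  set c : ℝ := ‖(W - 1) i₀ j₀‖ with hc
  have hc0 : 0 ≤ c := norm_nonneg _
  have hTc : ∀ i j, ‖(W - 1) i j‖ ≤ c := fun i j => hmax ⟨i, j⟩ (Finset.mem_univ _)
  -- `‖T_{ij}‖ ≤ max (π⁻¹ u) (π⁻¹ d c)`
  have hbound : ∀ i j, ‖(W - 1) i j‖ ≤ max (π⁻¹ * u) (π⁻¹ * d * c) := by
    intro i j
    rw [hRT i j]
    refine (norm_add_le_max' _ _).trans (max_le_max ?_ ?_)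
    · exact (norm_Rhat_le hp hn _).trans (mul_le_mul_of_nonneg_left (heu i j) hπi0)
    · have h : RD i j - (RD * W) i j = -((RD * (W - 1)) i j) := by
        rw [Matrix.mul_sub, Matrix.mul_one, Matrix.sub_apply]; ring
      rw [h, norm_neg]
      exact norm_mul_apply_le (mul_nonneg hπi0 hd0) hc0 hRDn hTc i j
  -- `π⁻¹ d < 1` forces `c ≤ π⁻¹ u`
  have hθ : π⁻¹ * d < 1 := by rw [inv_mul_lt_iff₀ hπ0, mul_one]; exact hd
  have hcle : c ≤ π⁻¹ * u := by
    by_contra hlt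
    have hlt' : π⁻¹ * u < c := not_le.mp hlt
    have hcpos : 0 < c := lt_of_le_of_lt (mul_nonneg hπi0 hu0) hlt'
    have h := hbound i₀ j₀
    rw [← hc] at h
    rcases le_max_iff.mp h with h1 | h1
    · exact hlt h1
    · exact absurd h1 (not_le.mpr (mul_lt_of_lt_one_left hcpos hθ))
  intro i j
  exact (hTc i j).trans hcle

/-! ### Cor. 3.2.4 with the bound on the decompleted value -/

/-- ★ **Berger–Colmez Cor. 3.2.4 over the cyclotomic tower, with the a priori bound.** For `n ≥ 2` and
`U ∈ M_d(X)` with `‖U − 1‖ ≤ ‖p‖⁷` there is `B ∈ GL_d(X)` with `‖B − 1‖ ≤ ‖p‖²`, `B⁻¹ ∈ M_d(X)`, such that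
`W = B⁻¹ U γ_n(B) ∈ M_d(X)` is fixed by `γ_n` entrywise (`∈ M_d(K_n)`) and `‖W − 1‖ ≤ ‖p‖⁶`.
[cite: BergerColmez2008, Cor. 3.2.4 and Prop. 3.2.6] [cite: Tate1967, §3.2 Prop. 7] -/
theorem exists_matrix_conj_fixed_near_one {n : ℕ} (hn : 2 ≤ n) {U : Matrix m m (CompletedAlgClosure F)}
    (hU : ∀ i j, U i j ∈ X hp) (hU1 : ∀ i j, ‖(U - 1) i j‖ ≤ ‖(p : PadicBase F p hp)‖ ^ 7) :
    ∃ B : Matrix m m (CompletedAlgClosure F), (∀ i j, B i j ∈ X hp) ∧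
      (∀ i j, ‖(B - 1) i j‖ ≤ ‖(p : PadicBase F p hp)‖ ^ 2) ∧ IsUnit B.det ∧
      (∀ i j, B⁻¹ i j ∈ X hp) ∧
      (∀ i j, (B⁻¹ * U * B.map fun x => gen hp n • x) i j ∈ X hp) ∧
      (∀ i j, gen hp n • (B⁻¹ * U * B.map fun x => gen hp n • x) i j =
        (B⁻¹ * U * B.map fun x => gen hp n • x) i j) ∧
      ∀ i j, ‖((B⁻¹ * U * B.map fun x => gen hp n • x) - 1) i j‖ ≤ ‖(p : PadicBase F p hp)‖ ^ 6 := by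
  obtain ⟨B, hBX, hB1, hdet, hBinvX, hWX, hγW⟩ := exists_matrix_conj_fixed hp hn hU hU1
  have hπ0 : 0 < ‖(p : PadicBase F p hp)‖ :=
    norm_pos_iff.mpr (by exact_mod_cast (Fact.out : p.Prime).ne_zero)
  have hπ1 : ‖(p : PadicBase F p hp)‖ < 1 := PadicBase.norm_p_lt_one hp
  refine ⟨B, hBX, hB1, hdet, hBinvX, hWX, hγW, fun i j => ?_⟩
  have hBW : B * (B⁻¹ * U * B.map fun x => gen hp n • x) = U * B.map fun x => gen hp n • x := by
    rw [Matrix.mul_assoc, Matrix.mul_nonsing_inv_cancel_left B _ hdet]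
  have h := norm_fixed_conj_sub_one_le hp hn hBX hU hWX hγW hBW (pow_nonneg hπ0.le 2)
    (by nlinarith [pow_pos hπ0 2]) (pow_nonneg hπ0.le 7) hB1 hU1 i j
  refine h.trans (le_of_eq ?_)
  rw [show (7 : ℕ) = 1 + 6 from rfl, pow_add, pow_one, ← mul_assoc, inv_mul_cancel₀ hπ0.ne', one_mul]

/-! ### Berger–Colmez Prop. 3.2.6: one coboundary decompletes the whole cocycle -/

/-- ★★ **Sen's decompletion of a cocycle (Berger–Colmez Prop. 3.2.6, cyclotomic tower, after the
`H`-descent).** Let `n ≥ 2`, `γ = γ_n`, and `U_γ ∈ M_d(X)` with `‖U_γ − 1‖ ≤ ‖p‖⁷`. There is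
`B ∈ GL_d(X)` with `‖B − 1‖ ≤ ‖p‖²` such that `B⁻¹ U_γ γ(B)` is fixed by `γ` entrywise, and such that for
every `τ ∈ G₀` and every `U_τ ∈ M_d(X)` satisfying the commutation relation `U_γ · γ(U_τ) = U_τ · τ(U_γ)`
the matrix `B⁻¹ U_τ τ(B)` is fixed by `γ` entrywise too. For a continuous `1`-cocycle `σ ↦ U_σ` on `G₀`
with values in `GL_d(X)` (inflated from `G₀/H₀`), the relation holds for all `τ` because `γτ = τγ` on `X`
(`gen_smul_comm_of_mem_X`), so the cohomologous cocycle `σ ↦ B⁻¹ U_σ σ(B)` takes values in `GL_d(K_n)`: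
this is the finiteness/decompletion half of Sen's theory. [cite: BergerColmez2008, Prop. 3.2.6]
[cite: Sen1980, Theorem 3] [cite: Tate1967, §3.3] -/
theorem exists_matrix_conj_fixed_forall {n : ℕ} (hn : 2 ≤ n) {Uγ : Matrix m m (CompletedAlgClosure F)}
    (hUγ : ∀ i j, Uγ i j ∈ X hp) (hUγ1 : ∀ i j, ‖(Uγ - 1) i j‖ ≤ ‖(p : PadicBase F p hp)‖ ^ 7) :
    ∃ B : Matrix m m (CompletedAlgClosure F), (∀ i j, B i j ∈ X hp) ∧
      (∀ i j, ‖(B - 1) i j‖ ≤ ‖(p : PadicBase F p hp)‖ ^ 2) ∧ IsUnit B.det ∧ (∀ i j, B⁻¹ i j ∈ X hp) ∧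
      (∀ i j, gen hp n • (B⁻¹ * Uγ * B.map fun x => gen hp n • x) i j =
        (B⁻¹ * Uγ * B.map fun x => gen hp n • x) i j) ∧
      ∀ (τ : BaseGaloisGroup hp) (Uτ : Matrix m m (CompletedAlgClosure F)), (∀ i j, Uτ i j ∈ X hp) →
        Uγ * (Uτ.map fun x => gen hp n • x) = Uτ * (Uγ.map fun x => τ • x) →
        ∀ i j, gen hp n • (B⁻¹ * Uτ * B.map fun x => τ • x) i j = (B⁻¹ * Uτ * B.map fun x => τ • x) i j := by
  obtain ⟨B, hBX, hB1, hdet, hBinvX, hWX, hγW, hW1⟩ := exists_matrix_conj_fixed_near_one hp hn hUγ hUγ1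
  have hπ0 : 0 < ‖(p : PadicBase F p hp)‖ :=
    norm_pos_iff.mpr (by exact_mod_cast (Fact.out : p.Prime).ne_zero)
  have hπ1 : ‖(p : PadicBase F p hp)‖ < 1 := PadicBase.norm_p_lt_one hp
  refine ⟨B, hBX, hB1, hdet, hBinvX, hγW, fun τ Uτ hUτ hrel => ?_⟩
  -- ring homomorphisms for `γ` and `τ`
  set fγ : CompletedAlgClosure F →+* CompletedAlgClosure F :=
    MulSemiringAction.toRingHom (BaseGaloisGroup hp) (CompletedAlgClosure F) (gen hp n) with hfγ_def
  have hfγ : (fun x : CompletedAlgClosure F => gen hp n • x) = ⇑fγ := by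
    funext x; simp [hfγ_def]
  set fτ : CompletedAlgClosure F →+* CompletedAlgClosure F :=
    MulSemiringAction.toRingHom (BaseGaloisGroup hp) (CompletedAlgClosure F) τ with hfτ_def
  have hfτ : (fun x : CompletedAlgClosure F => τ • x) = ⇑fτ := by
    funext x; simp [hfτ_def]
  -- `W = B⁻¹ U_γ γ(B)`, `V = B⁻¹ U_τ τ(B)`
  have hcomm : ∀ {A : Matrix m m (CompletedAlgClosure F)}, (∀ i j, A i j ∈ X hp) →
      (A.map ⇑fτ).map ⇑fγ = (A.map ⇑fγ).map ⇑fτ := by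
    intro A hA
    have h := map_gen_map_base_comm hp n τ hA
    rwa [hfγ, hfτ] at h
  have hcancel : ∀ (g : CompletedAlgClosure F →+* CompletedAlgClosure F), B.map ⇑g * B⁻¹.map ⇑g = 1 := by
    intro g
    rw [← Matrix.map_mul, Matrix.mul_nonsing_inv B hdet, Matrix.map_one g (map_zero g) (map_one g)]
  have hVX : ∀ i j, (B⁻¹ * Uτ * B.map fun x => τ • x) i j ∈ X hp :=
    mul_apply_mem_X hp (mul_apply_mem_X hp hBinvX hUτ) (map_smul_apply_mem_X hp τ hBX)
  -- `W γ(V) = V τ(W)`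
  have hrel' : Uγ * Uτ.map ⇑fγ = Uτ * Uγ.map ⇑fτ := by rw [← hfγ, ← hfτ]; exact hrel
  have hWV : (B⁻¹ * Uγ * B.map ⇑fγ) * (B⁻¹ * Uτ * B.map ⇑fτ).map ⇑fγ =
      (B⁻¹ * Uτ * B.map ⇑fτ) * (B⁻¹ * Uγ * B.map ⇑fγ).map ⇑fτ := by
    rw [Matrix.map_mul, Matrix.map_mul, Matrix.map_mul, Matrix.map_mul, hcomm hBX]
    calc B⁻¹ * Uγ * B.map ⇑fγ * (B⁻¹.map ⇑fγ * Uτ.map ⇑fγ * (B.map ⇑fγ).map ⇑fτ)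
        = B⁻¹ * Uγ * (B.map ⇑fγ * B⁻¹.map ⇑fγ) * Uτ.map ⇑fγ * (B.map ⇑fγ).map ⇑fτ := by noncomm_ring
      _ = B⁻¹ * (Uγ * Uτ.map ⇑fγ) * (B.map ⇑fγ).map ⇑fτ := by rw [hcancel fγ]; noncomm_ring
      _ = B⁻¹ * (Uτ * Uγ.map ⇑fτ) * (B.map ⇑fγ).map ⇑fτ := by rw [hrel']
      _ = B⁻¹ * Uτ * (B.map ⇑fτ * B⁻¹.map ⇑fτ) * Uγ.map ⇑fτ * (B.map ⇑fγ).map ⇑fτ := by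
          rw [hcancel fτ]; noncomm_ring
      _ = B⁻¹ * Uτ * B.map ⇑fτ * (B⁻¹.map ⇑fτ * Uγ.map ⇑fτ * (B.map ⇑fγ).map ⇑fτ) := by noncomm_ring
  -- `W` is invertible (`‖W − 1‖ ≤ π⁶ < 1`), so `γ(V) = W⁻¹ V τ(W)`
  have hπ6 : ‖(p : PadicBase F p hp)‖ ^ 6 < 1 := pow_lt_one₀ hπ0.le hπ1 (by norm_num)
  have hW1' : ∀ i j, ‖((B⁻¹ * Uγ * B.map ⇑fγ) - 1) i j‖ ≤ ‖(p : PadicBase F p hp)‖ ^ 6 := by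
    rw [← hfγ]; exact hW1
  obtain ⟨hdetW, -⟩ := isUnit_det_and_norm_inv_sub_one_le (pow_nonneg hπ0.le 6) hπ6 hW1'
  have hγV : (B⁻¹ * Uτ * B.map ⇑fτ).map ⇑fγ =
      (B⁻¹ * Uγ * B.map ⇑fγ)⁻¹ * (B⁻¹ * Uτ * B.map ⇑fτ) * (B⁻¹ * Uγ * B.map ⇑fγ).map ⇑fτ := by
    have h : (B⁻¹ * Uγ * B.map ⇑fγ)⁻¹ * ((B⁻¹ * Uγ * B.map ⇑fγ) * (B⁻¹ * Uτ * B.map ⇑fτ).map ⇑fγ) =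
        (B⁻¹ * Uγ * B.map ⇑fγ)⁻¹ * ((B⁻¹ * Uτ * B.map ⇑fτ) * (B⁻¹ * Uγ * B.map ⇑fγ).map ⇑fτ) := by
      rw [hWV]
    rwa [Matrix.nonsing_inv_mul_cancel_left _ _ hdetW, ← Matrix.mul_assoc] at h
  -- apply the propagation lemma with `r = π⁶ < π²`
  have hr : ‖(p : PadicBase F p hp)‖ ^ 6 < ‖(p : PadicBase F p hp)‖ ^ 2 :=
    pow_lt_pow_right_of_lt_one₀ hπ0 hπ1 (by norm_num)
  have hWX' : ∀ i j, (B⁻¹ * Uγ * B.map ⇑fγ) i j ∈ X hp := by rw [← hfγ]; exact hWX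
  have hγW' : ∀ i j, gen hp n • (B⁻¹ * Uγ * B.map ⇑fγ) i j = (B⁻¹ * Uγ * B.map ⇑fγ) i j := by
    rw [← hfγ]; exact hγW
  have hVX' : ∀ i j, (B⁻¹ * Uτ * B.map ⇑fτ) i j ∈ X hp := by rw [← hfτ]; exact hVX
  have hγV' : ((B⁻¹ * Uτ * B.map ⇑fτ).map fun x => gen hp n • x) =
      (B⁻¹ * Uγ * B.map ⇑fγ)⁻¹ * (B⁻¹ * Uτ * B.map ⇑fτ) *
        (B⁻¹ * Uγ * B.map ⇑fγ).map fun x => τ • x := by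
    rw [hfγ, hfτ]; exact hγV
  have h := matrix_gen_smul_eq_of_map_eq_inv_mul_map hp hn τ hWX' hγW' hr hW1' hVX' hγV'
  rw [hfτ]
  exact h

end TateTrace

end Literature.NumberTheory.PAdicHodge
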